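import Summits.NavierStokesRegularity.FunctionalMining.HyperdissipativeStretching
import Literature.Analysis.FluidPDE.FracNSEnergy
import Literature.Analysis.FluidPDE.FracTransportHigher
import Literature.Analysis.FluidPDE.TorusClassicalH1Balance
import HarnessLib

/-!
# FunctionalMining — the enstrophy of the hyperdissipative model at and above J.-L. Lions'
# exponent `α ≥ 5/4` is bounded a priori: `‖∇u(t)‖₂² ≤ ‖∇u(a)‖₂² · exp(C ‖u(a)‖₂² / (2ν²))`

Search for candidate a priori estimates; no regularity claim. Cell `pub-nsfunc`, prove seat
(gen 25). Part 3 of the kernel form of the paper fragment `estimates.tex` Prop. "fragments with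
honest scope" (d) (parts 1–2: `HyperdissipativeSobolev`, `HyperdissipativeStretching`). Along a
classical solution of the fractional Navier–Stokes(–Reynolds) system
`∂ₜu + (u·∇)u + ∇p + ν(−Δ)^θ u = div R`, `div u = 0` on `T³ × [a, b]` (tree
`Torus.IsFracNSReynoldsOn`, Luo–Titi 2020 (2.1); the MODEL is `R = 0`):

* `hasDerivWithinAt_half_gradNormSq_frac` — the `H¹` balance
  `d/dt ½‖∇u‖₂² = −ν ‖Λ^θ∇u‖₂² + ∫⟪(u·∇)u − div R, Δu⟫` within `[a, b]` (`θ ≥ 0`; the classical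
  `TorusClassicalH1Balance` computation with `∫⟪(−Δ)^θ u, Δu⟫ = −‖Λ^θ∇u‖₂²`
  (`integral_inner_fracLaplacian_laplacian`: Green's identity and `∂ₘ(−Δ)^θ = (−Δ)^θ∂ₘ`), and
  `∫⟪∇p, Δu⟫ = 0`);
* `fracGradPairing_mono` (`‖Λ^{θ₁}∇u‖₂² ≤ ‖Λ^{θ₂}∇u‖₂²`, `0 < θ₁ ≤ θ₂`), `fracGradPairing_sub_one_eq`
  (`‖Λ^{α−1}∇u‖₂² = ∫⟪u,(−Δ)^α u⟫ = ‖Λ^α u‖₂²`, `α ≥ 1`) and the static budget for EVERY `α ≥ 5/4`,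
  `two_mul_abs_stretching_le_hyperdissipation_of_le`:
  `2|∫⟪(u·∇)u, Δu⟫| ≤ ν‖Λ^α∇u‖₂² + (C/ν)‖∇u‖₂²‖Λ^{α−1}∇u‖₂²`;
* **`gradNormSq_le_mul_exp_of_fracNS`** — for the model (`R = 0`), `α ≥ 5/4`, `ν > 0`:
  `‖∇u(t)‖₂² ≤ ‖∇u(a)‖₂² · exp(C (‖u(a)‖₂² − ‖u(t)‖₂²) / (2ν²))` on `[a, b]`
  (`Y' ≤ (C/ν)·‖Λ^α u‖₂²·Y` and `d/dt ‖u‖₂² = −2ν‖Λ^α u‖₂²`, so `Y · exp(C‖u‖₂²/(2ν²))` is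
  non-increasing — no time integral is formed); **`gradNormSq_le_mul_exp_initial_of_fracNS`**
  (`≤ ‖∇u(a)‖₂² exp(C‖u(a)‖₂²/(2ν²))`) and the row `α = 5/4` itself, `…_fiveQuarter`.

This is the a priori `H¹` control behind J.-L. Lions' global regularity of the model for `α ≥ 5/4`
(*Quelques méthodes de résolution des problèmes aux limites non linéaires* (1969), Ch. I §6,
Rem. 6.11) in the cell's vocabulary; the theorem itself (existence/continuation) is NOT restated or
claimed. LOCATED GAP: `α = 1` (Navier–Stokes) admits no such closing by this chain (tree
`Torus.abs_integral_inner_convect_laplacian_le_dissipation`: `Y' ≤ (16K⁴/ν³) Y³`). Constants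
existential. [ours]
-/

noncomputable section

open MeasureTheory Set Filter Topology Finset
open scoped InnerProductSpace

namespace Summit.NavierStokesRegularity.FunctionalMining

namespace HyperNS

open Literature.Analysis.FunctionSpaces Literature.Analysis.FunctionSpaces.Torus
open Literature.Analysis.FluidPDE Literature.Analysis.FluidPDE.Torus

/-! ## 1. `∫⟪(−Δ)^θ u, Δu⟫ = −‖Λ^θ∇u‖₂²` and the `H¹` balance of the fractional system -/

/-- **`∫ ⟪(−Δ)^θ u, Δu⟫ = −‖Λ^θ ∇u‖₂²`** for smooth `u` on `T³` (`θ ≥ 0`): Green's identity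
`∑ₘ∫⟪∂ₘa, ∂ₘu⟫ = −∫⟪a, Δu⟫` with `a = (−Δ)^θu` and `∂ₘ(−Δ)^θ u = (−Δ)^θ ∂ₘu`
(`Torus.partialDeriv_fracLaplacian_comm`). [ours, bookkeeping] -/
theorem integral_inner_fracLaplacian_laplacian {θ : ℝ} (hθ : 0 ≤ θ)
    {u : UnitAddTorus (Fin 3) → EuclideanSpace ℝ (Fin 3)} (hu : Torus.IsSmooth u) :
    ∫ x, ⟪fracLaplacian θ u x, Torus.laplacian u x⟫_ℝ = -fracGradPairing θ u := by
  have hL : Torus.IsSmooth (fracLaplacian θ u) := hu.fracLaplacian hθ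
  have h := Torus.sum_integral_inner_partialDeriv_eq_neg_integral_inner_laplacian hL hu
  have h' : ∫ x, ⟪fracLaplacian θ u x, Torus.laplacian u x⟫_ℝ =
      -∑ i, ∫ x, ⟪Torus.partialDeriv i (fracLaplacian θ u) x, Torus.partialDeriv i u x⟫_ℝ := by
    linarith
  rw [h']
  unfold fracGradPairing
  congr 1
  refine Finset.sum_congr rfl fun m _ => ?_
  rw [partialDeriv_fracLaplacian_comm hθ hu m]
  exact integral_congr_ae (ae_of_all _ fun x => real_inner_comm _ _)

/-- **The `H¹` balance of the fractional Navier–Stokes–Reynolds system on `T³`.** For a classical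
solution of `∂ₜu + (u·∇)u + ∇p + ν(−Δ)^θ u = div R`, `div u = 0` on `T³ × [a, b]` (`a < b`,
`θ ≥ 0`) and every `t ∈ [a, b]`:
`d/dt ½‖∇u(t)‖₂² = −ν ‖Λ^θ∇u(t)‖₂² + ∫ ⟪(u·∇)u(t) − div R(t), Δu(t)⟫` as a one-sided derivative
within `[a, b]` — the computation of the tree's `IsClassicalNSSolutionOn.hasDerivWithinAt_half_gradNormSq`
(pair `∂ₜu` with `−Δu`, `∂ₜ∂ᵢ = ∂ᵢ∂ₜ`, Green, the pressure drops out since `Δu` is divergence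
free) with the hyperviscous term evaluated by `integral_inner_fracLaplacian_laplacian`. [ours] -/
theorem hasDerivWithinAt_half_gradNormSq_frac {a b θ ν : ℝ}
    {u : ℝ → UnitAddTorus (Fin 3) → EuclideanSpace ℝ (Fin 3)} {p : ℝ → UnitAddTorus (Fin 3) → ℝ}
    {R : ℝ → UnitAddTorus (Fin 3) → Fin 3 → EuclideanSpace ℝ (Fin 3)}
    (h : Torus.IsFracNSReynoldsOn (Icc a b) θ ν u p R) (hab : a < b) (hθ : 0 ≤ θ) {t : ℝ}
    (ht : t ∈ Icc a b) :
    HasDerivWithinAt (fun s => 2⁻¹ * Torus.gradNormSq (u s))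
      (-ν * fracGradPairing θ (u t) +
        ∫ x, ⟪Torus.convect (u t) (u t) x - tensorDivergence (R t) x, Torus.laplacian (u t) x⟫_ℝ)
      (Icc a b) t := by
  set S : Set ℝ := Icc a b with hSdef
  have hSc : Convex ℝ S := convex_Icc a b
  have hU : UniqueDiffOn ℝ S := uniqueDiffOn_Icc hab
  have hus : Torus.IsSmoothSpaceTimeOn S u := h.smooth_velocity
  have hut : Torus.IsSmooth (u t) := hus.isSmooth_slice ht
  have hpt : Torus.IsSmooth (p t) := h.smooth_pressure.isSmooth_slice ht
  have hRt : Torus.IsSmooth (R t) := h.smooth_stress.isSmooth_slice ht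
  have hA : Torus.IsSmooth (Torus.timeDerivWithin S u t) := hus.isSmooth_timeDerivWithin hU ht
  have hΔ : Torus.IsSmooth (Torus.laplacian (u t)) := hut.laplacian
  have hL : Torus.IsSmooth (fracLaplacian θ (u t)) := hut.fracLaplacian hθ
  have hDi : ∀ i, Torus.IsSmoothSpaceTimeOn S (fun s => Torus.partialDeriv i (u s)) :=
    fun i => hus.partialDeriv hU i
  -- Step 1: differentiate `½ ∫ ∑ᵢ ‖∂ᵢu‖²` under the integral sign.
  have hφ : Torus.IsSmoothSpaceTimeOn S (fun s x => ∑ i, ‖Torus.partialDeriv i (u s) x‖ ^ 2) := by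
    change ContDiffOn ℝ (⊤ : ℕ∞)
      (fun z => ∑ i, ‖Torus.stLift (fun s => Torus.partialDeriv i (u s)) z‖ ^ 2) (S ×ˢ univ)
    exact ContDiffOn.sum fun i _ => (hDi i).norm_sq ℝ
  have hE : HasDerivWithinAt (fun s => 2⁻¹ * Torus.gradNormSq (u s))
      (2⁻¹ * ∫ x, Torus.timeDerivWithin S
        (fun s x => ∑ i, ‖Torus.partialDeriv i (u s) x‖ ^ 2) t x) S t :=
    (hφ.hasDerivWithinAt_integral hSc ht).const_mul 2⁻¹
  -- Step 2: `∂ₜ ∑ᵢ ‖∂ᵢu‖² = 2 ∑ᵢ ⟪∂ᵢ∂ₜu, ∂ᵢu⟫`.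
  have htd : ∀ x, Torus.timeDerivWithin S (fun s x => ∑ i, ‖Torus.partialDeriv i (u s) x‖ ^ 2) t x =
      2 * ∑ i, ⟪Torus.partialDeriv i (Torus.timeDerivWithin S u t) x,
        Torus.partialDeriv i (u t) x⟫_ℝ := by
    intro x
    have hsum := HasDerivWithinAt.fun_sum (u := Finset.univ)
      (A := fun i s => ‖Torus.partialDeriv i (u s) x‖ ^ 2)
      (A' := fun i => 2 * ⟪Torus.partialDeriv i (u t) x,
        Torus.timeDerivWithin S (fun s => Torus.partialDeriv i (u s)) t x⟫_ℝ) (x := t) (s := S)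
      fun i _ => ((hDi i).hasDerivWithinAt_slice ht x).norm_sq
    have h2 := hsum.derivWithin (hU t ht)
    rw [Torus.timeDerivWithin, h2, Finset.mul_sum]
    refine Finset.sum_congr rfl fun i _ => ?_
    rw [Torus.timeDerivWithin_partialDeriv_comm hab hus ht i x, real_inner_comm]
  -- Step 3: Green, `∑ᵢ ∫ ⟪∂ᵢ∂ₜu, ∂ᵢu⟫ = -∫ ⟪∂ₜu, Δu⟫`.
  have hE' : 2⁻¹ * ∫ x, Torus.timeDerivWithin S
        (fun s x => ∑ i, ‖Torus.partialDeriv i (u s) x‖ ^ 2) t x =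
      -∫ x, ⟪Torus.timeDerivWithin S u t x, Torus.laplacian (u t) x⟫_ℝ := by
    simp_rw [htd, integral_const_mul]
    rw [integral_finsetSum _ fun i _ => ((hA.partialDeriv i).inner (hut.partialDeriv i)).integrable,
      Torus.sum_integral_inner_partialDeriv_eq_neg_integral_inner_laplacian hA hut]
    ring
  rw [hE'] at hE
  convert hE using 1
  -- Step 4: insert the momentum equation; the pressure term drops out.
  have hA_eq : ∀ x, Torus.timeDerivWithin S u t x = tensorDivergence (R t) x -
      Torus.convect (u t) (u t) x - Torus.gradient (p t) x - ν • fracLaplacian θ (u t) x := by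
    intro x
    rw [← h.momentum t ht x]
    abel
  have iL : Integrable (fun x => ⟪ν • fracLaplacian θ (u t) x, Torus.laplacian (u t) x⟫_ℝ) volume :=
    ((hL.smul ν).inner hΔ).integrable
  have iG : Integrable (fun x => ⟪Torus.gradient (p t) x, Torus.laplacian (u t) x⟫_ℝ) volume :=
    (hpt.gradient.inner hΔ).integrable
  have iR : Integrable (fun x => ⟪tensorDivergence (R t) x, Torus.laplacian (u t) x⟫_ℝ) volume :=
    (hRt.tensorDivergence.inner hΔ).integrable
  have iC : Integrable (fun x => ⟪Torus.convect (u t) (u t) x, Torus.laplacian (u t) x⟫_ℝ) volume :=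
    ((hut.convect hut).inner hΔ).integrable
  have hsplit : ∫ x, ⟪Torus.timeDerivWithin S u t x, Torus.laplacian (u t) x⟫_ℝ =
      (∫ x, ⟪tensorDivergence (R t) x, Torus.laplacian (u t) x⟫_ℝ) -
        (∫ x, ⟪Torus.convect (u t) (u t) x, Torus.laplacian (u t) x⟫_ℝ) -
        (∫ x, ⟪Torus.gradient (p t) x, Torus.laplacian (u t) x⟫_ℝ) -
        ∫ x, ⟪ν • fracLaplacian θ (u t) x, Torus.laplacian (u t) x⟫_ℝ := by
    simp_rw [hA_eq, inner_sub_left]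
    rw [integral_sub ?_ iL, integral_sub ?_ iG, integral_sub iR iC]
    · exact iR.sub iC
    · exact (iR.sub iC).sub iG
  have hvisc : ∫ x, ⟪ν • fracLaplacian θ (u t) x, Torus.laplacian (u t) x⟫_ℝ =
      -ν * fracGradPairing θ (u t) := by
    simp_rw [real_inner_smul_left]
    rw [integral_const_mul, integral_inner_fracLaplacian_laplacian hθ hut]
    ring
  have hpres : ∫ x, ⟪Torus.gradient (p t) x, Torus.laplacian (u t) x⟫_ℝ = 0 :=
    Torus.integral_inner_gradient_eq_zero_of_isDivFree hΔ hpt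
      (Torus.IsDivFree.laplacian_of_isSmooth hut (h.divFree t ht))
  have hCR : ∫ x, ⟪Torus.convect (u t) (u t) x - tensorDivergence (R t) x, Torus.laplacian (u t) x⟫_ℝ =
      (∫ x, ⟪Torus.convect (u t) (u t) x, Torus.laplacian (u t) x⟫_ℝ) -
        ∫ x, ⟪tensorDivergence (R t) x, Torus.laplacian (u t) x⟫_ℝ := by
    simp_rw [inner_sub_left]
    exact integral_sub iC iR
  rw [hsplit, hvisc, hpres, hCR]
  ring

/-! ## 2. Every `α ≥ 5/4`: symbol monotonicity and the general static budget -/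

/-- **`‖Λ^{θ₁}∇u‖₂² ≤ ‖Λ^{θ₂}∇u‖₂²` for `0 < θ₁ ≤ θ₂`** (smooth `u` on `T³`): the symbol
`(4π²|k|²)^θ` is non-decreasing in `θ` at every `k ≠ 0` (`4π²|k|² ≥ 1`) and vanishes at `k = 0`.
[ours, bookkeeping] -/
theorem fracGradPairing_mono {θ₁ θ₂ : ℝ} (h₁ : 0 < θ₁) (h₁₂ : θ₁ ≤ θ₂)
    {u : UnitAddTorus (Fin 3) → EuclideanSpace ℝ (Fin 3)} (hu : Torus.IsSmooth u) :
    fracGradPairing θ₁ u ≤ fracGradPairing θ₂ u := by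
  have h₂ : 0 ≤ θ₂ := h₁.le.trans h₁₂
  rw [fracGradPairing_eq_sum_tsum h₁.le hu, fracGradPairing_eq_sum_tsum h₂ hu]
  refine Finset.sum_le_sum fun m _ => ?_
  refine (summable_fracSymbol_mul_norm_sq h₁.le (hu.partialDeriv m)).tsum_le_tsum (fun k => ?_)
    (summable_fracSymbol_mul_norm_sq h₂ (hu.partialDeriv m))
  refine mul_le_mul_of_nonneg_right ?_ (gradCoeffSq_nonneg u m k)
  simp only [fracSymbol]
  by_cases hk : k = 0
  · subst hk
    rw [freqNormSq_zero, mul_zero, Real.zero_rpow h₁.ne', Real.zero_rpow (by linarith)]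
  · have h1 : (1 : ℝ) ≤ 4 * Real.pi ^ 2 * freqNormSq k := by
      have hf := Torus.one_le_freqNormSq_of_ne_zero hk
      have hπ : (1 : ℝ) ≤ 4 * Real.pi ^ 2 := by have := Real.pi_gt_three; nlinarith
      nlinarith
    exact Real.rpow_le_rpow_of_exponent_le h1 h₁₂

/-- **`‖Λ^{α−1}∇u‖₂² = ‖Λ^α u‖₂² = ∫⟪u, (−Δ)^α u⟫`** for smooth `u` and `α ≥ 1` (Fourier side:
`∑ₘ‖(∂ₘu)^(k)‖² = 4π²|k|²‖û(k)‖²`, `(4π²|k|²)^{α−1}·4π²|k|² = (4π²|k|²)^α`) — the energy-dissipation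
rate (per unit viscosity) of the `α` model. [ours, bookkeeping] -/
theorem fracGradPairing_sub_one_eq {α : ℝ} (hα : 1 ≤ α)
    {u : UnitAddTorus (Fin 3) → EuclideanSpace ℝ (Fin 3)} (hu : Torus.IsSmooth u) :
    fracGradPairing (α - 1) u = ∫ x, ⟪u x, fracLaplacian α u x⟫_ℝ := by
  have h0 : 0 ≤ α - 1 := by linarith
  rw [fracGradPairing_eq_sum_tsum h0 hu, integral_inner_self_fracLaplacian_eq_tsum (by linarith) hu]
  have hS : ∀ m, Summable fun k : Fin 3 → ℤ => fracSymbol (α - 1) k * gradCoeffSq u m k := fun m =>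
    summable_fracSymbol_mul_norm_sq h0 (hu.partialDeriv m)
  rw [← Summable.tsum_finsetSum (fun m _ => hS m)]
  refine tsum_congr fun k => ?_
  rw [← Finset.mul_sum, sum_gradCoeffSq_eq hu k]
  have hx : 0 ≤ 4 * Real.pi ^ 2 * freqNormSq k := by
    have := freqNormSq_nonneg k; positivity
  simp only [fracSymbol]
  rw [show α = (α - 1) + 1 by ring, Real.rpow_add' hx (by linarith), Real.rpow_one,
    show α - 1 + 1 - 1 = α - 1 by ring]
  ring

/-- **The static budget for every `α ≥ 5/4`.** With the constant `C` of
`two_mul_abs_stretching_le_hyperdissipation`: for smooth divergence-free `u` on `T³`, `ν > 0` and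
`α ≥ 5/4`, `2|∫⟪(u·∇)u, Δu⟫| ≤ ν ‖Λ^α∇u‖₂² + (C/ν) ‖∇u‖₂² ‖Λ^{α−1}∇u‖₂²` (symbol monotonicity from
the `α = 5/4` row). [ours] -/
theorem two_mul_abs_stretching_le_hyperdissipation_of_le :
    ∃ C : ℝ, 0 ≤ C ∧ ∀ u : UnitAddTorus (Fin 3) → EuclideanSpace ℝ (Fin 3), Torus.IsSmooth u →
      Torus.IsDivFree u → ∀ {ν α : ℝ}, 0 < ν → 5 / 4 ≤ α →
      2 * |∫ x, ⟪Torus.convect u u x, Torus.laplacian u x⟫_ℝ| ≤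
        ν * fracGradPairing α u + C / ν * Torus.gradNormSq u * fracGradPairing (α - 1) u := by
  obtain ⟨C, hC0, hC⟩ := two_mul_abs_stretching_le_hyperdissipation
  refine ⟨C, hC0, fun u hu hdiv ν α hν hα => ?_⟩
  have h1 := hC u hu hdiv hν
  have h5 : fracGradPairing (5 / 4) u ≤ fracGradPairing α u :=
    fracGradPairing_mono (by norm_num) hα hu
  have h4 : fracGradPairing (1 / 4) u ≤ fracGradPairing (α - 1) u :=
    fracGradPairing_mono (by norm_num) (by linarith) hu
  have hY : 0 ≤ C / ν * Torus.gradNormSq u := by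
    have := Torus.gradNormSq_nonneg u; positivity
  nlinarith [mul_le_mul_of_nonneg_left h4 hY, mul_le_mul_of_nonneg_left h5 hν.le]

/-! ## 3. The a priori enstrophy bound of the model, every `α ≥ 5/4` -/


/-- **A priori enstrophy bound at and above Lions' exponent.** There is `C ≥ 0` (the constant of
`two_mul_abs_stretching_le_hyperdissipation`) such that for every `α ≥ 5/4`, every `ν > 0` and every
classical solution of the hyperdissipative model `∂ₜu + (u·∇)u + ∇p + ν(−Δ)^α u = 0`, `div u = 0` on
`T³ × [a, b]` (`Torus.IsFracNSReynoldsOn` with zero stress), for all `t ∈ [a, b]`: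
`‖∇u(t)‖₂² ≤ ‖∇u(a)‖₂² · exp(C · (‖u(a)‖₂² − ‖u(t)‖₂²) / (2ν²))`.
Proof: by §1–§2, `Y = ‖∇u‖₂²` has `Y' ≤ (C/ν) D Y` with `D = ‖Λ^α u‖₂² = ‖Λ^{α−1}∇u‖₂²`
(`fracGradPairing_sub_one_eq`), while `d/dt ‖u‖₂² = −2νD` (`IsFracNSReynoldsOn.hasDerivWithinAt_energy`);
hence `s ↦ Y(s) · exp(C‖u(s)‖₂²/(2ν²))` has non-positive derivative within `[a, b]` and is
non-increasing (`antitoneOn_of_hasDerivWithinAt_nonpos`) — no time integral is formed. No statement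
beyond this a priori bound (existence, continuation) is made. [ours] -/
theorem gradNormSq_le_mul_exp_of_fracNS :
    ∃ C : ℝ, 0 ≤ C ∧ ∀ {α ν a b : ℝ}, 5 / 4 ≤ α → 0 < ν → a < b →
      ∀ {u : ℝ → UnitAddTorus (Fin 3) → EuclideanSpace ℝ (Fin 3)} {p : ℝ → UnitAddTorus (Fin 3) → ℝ},
      Torus.IsFracNSReynoldsOn (Icc a b) α ν u p (fun _ _ _ => 0) →
      ∀ t ∈ Icc a b, Torus.gradNormSq (u t) ≤ Torus.gradNormSq (u a) *
        Real.exp (C * ((∫ x, ‖u a x‖ ^ 2) - ∫ x, ‖u t x‖ ^ 2) / (2 * ν ^ 2)) := by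
  obtain ⟨C, hC0, hC⟩ := two_mul_abs_stretching_le_hyperdissipation_of_le
  refine ⟨C, hC0, ?_⟩
  intro α ν a b hα hν hab u p hsol t ht
  have h54 : (0 : ℝ) ≤ α := by linarith
  have hα1 : (1 : ℝ) ≤ α := by linarith
  set S : Set ℝ := Icc a b with hS
  -- the two balances
  set Y : ℝ → ℝ := fun s => Torus.gradNormSq (u s) with hY
  set K : ℝ → ℝ := fun s => ∫ x, ‖u s x‖ ^ 2 with hK
  set D : ℝ → ℝ := fun s => fracGradPairing (α - 1) (u s) with hD
  set G : ℝ → ℝ := fun s => Y s * Real.exp (C * K s / (2 * ν ^ 2)) with hG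
  have hsm : ∀ {s}, s ∈ S → Torus.IsSmooth (u s) := fun hs => hsol.smooth_velocity.isSmooth_slice hs
  have hdivs : ∀ {s}, s ∈ S → Torus.IsDivFree (u s) := fun hs => hsol.divFree _ hs
  -- `Y' = 2(−ν P₅ + ∫⟪convect, Δu⟫)` and `K' = −2ν D`
  have hYder : ∀ s ∈ S, HasDerivWithinAt Y (2 * (-ν * fracGradPairing α (u s) +
      ∫ x, ⟪Torus.convect (u s) (u s) x, Torus.laplacian (u s) x⟫_ℝ)) S s := by
    intro s hs
    have h1 := hasDerivWithinAt_half_gradNormSq_frac hsol hab h54 hs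
    have h1' := h1.congr_deriv (g' := -ν * fracGradPairing α (u s) +
        ∫ x, ⟪Torus.convect (u s) (u s) x, Torus.laplacian (u s) x⟫_ℝ) (by
      congr 1
      refine integral_congr_ae (ae_of_all _ fun x => ?_)
      simp [tensorDivergence, Torus.partialDeriv, Torus.lineDeriv])
    have h2 := h1'.const_mul 2
    have e1 : (fun s' => 2 * (2⁻¹ * Torus.gradNormSq (u s'))) = Y := by
      funext s'; simp only [hY]; ring
    rw [e1] at h2
    exact h2
  have hKder : ∀ s ∈ S, HasDerivWithinAt K (-(2 * ν * D s)) S s := by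
    intro s hs
    have h1 := hsol.hasDerivWithinAt_energy hab h54 hs
    have e0 : (∫ x, ∑ j, ⟪(fun (_ : ℝ) (_ : UnitAddTorus (Fin 3)) (_ : Fin 3) =>
        (0 : EuclideanSpace ℝ (Fin 3))) s x j, Torus.partialDeriv j (u s) x⟫_ℝ) = 0 := by simp
    rw [e0, mul_zero, zero_sub] at h1
    have e2 : ∫ x, ⟪fracLaplacian α (u s) x, u s x⟫_ℝ = D s := by
      simp only [hD]
      rw [fracGradPairing_sub_one_eq hα1 (hsm hs)]
      exact integral_congr_ae (ae_of_all _ fun x => real_inner_comm _ _)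
    rw [e2] at h1
    convert h1 using 1
  -- `Y' ≤ (C/ν) D Y`
  have hYle : ∀ s ∈ S, 2 * (-ν * fracGradPairing α (u s) +
      ∫ x, ⟪Torus.convect (u s) (u s) x, Torus.laplacian (u s) x⟫_ℝ) ≤ C / ν * D s * Y s := by
    intro s hs
    have h1 := hC (u s) (hsm hs) (hdivs hs) hν hα
    have h2 := le_abs_self (∫ x, ⟪Torus.convect (u s) (u s) x, Torus.laplacian (u s) x⟫_ℝ)
    have hP5 : 0 ≤ fracGradPairing α (u s) := fracGradPairing_nonneg h54 (hsm hs)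
    have e : C / ν * Torus.gradNormSq (u s) * fracGradPairing (α - 1) (u s) = C / ν * D s * Y s := by
      simp only [hD, hY]; ring
    nlinarith [mul_pos hν (show (0:ℝ) < 1 by norm_num)]
  -- `G' ≤ 0` within `S`
  have hGder : ∀ s ∈ S, HasDerivWithinAt G
      ((2 * (-ν * fracGradPairing α (u s) +
        ∫ x, ⟪Torus.convect (u s) (u s) x, Torus.laplacian (u s) x⟫_ℝ)) * Real.exp (C * K s / (2 * ν ^ 2)) +
        Y s * (Real.exp (C * K s / (2 * ν ^ 2)) * (C * (-(2 * ν * D s)) / (2 * ν ^ 2)))) S s := by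
    intro s hs
    have hexp : HasDerivWithinAt (fun s' => Real.exp (C * K s' / (2 * ν ^ 2)))
        (Real.exp (C * K s / (2 * ν ^ 2)) * (C * (-(2 * ν * D s)) / (2 * ν ^ 2))) S s :=
      (((hKder s hs).const_mul C).div_const (2 * ν ^ 2)).exp
    exact (hYder s hs).mul hexp
  have hGder_le : ∀ s ∈ S, (2 * (-ν * fracGradPairing α (u s) +
        ∫ x, ⟪Torus.convect (u s) (u s) x, Torus.laplacian (u s) x⟫_ℝ)) * Real.exp (C * K s / (2 * ν ^ 2)) +
        Y s * (Real.exp (C * K s / (2 * ν ^ 2)) * (C * (-(2 * ν * D s)) / (2 * ν ^ 2))) ≤ 0 := by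
    intro s hs
    have he : 0 < Real.exp (C * K s / (2 * ν ^ 2)) := Real.exp_pos _
    have h1 := mul_le_mul_of_nonneg_right (hYle s hs) he.le
    have e : Y s * (Real.exp (C * K s / (2 * ν ^ 2)) * (C * (-(2 * ν * D s)) / (2 * ν ^ 2))) =
        -(C / ν * D s * Y s) * Real.exp (C * K s / (2 * ν ^ 2)) := by
      field_simp
    rw [e]
    linarith
  -- `G` is antitone on `S`
  have hGcont : ContinuousOn G S := fun s hs => (hGder s hs).continuousWithinAt
  have hGanti : AntitoneOn G S := by
    refine antitoneOn_of_hasDerivWithinAt_nonpos (convex_Icc a b) hGcont (f' := fun s =>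
      (2 * (-ν * fracGradPairing α (u s) +
        ∫ x, ⟪Torus.convect (u s) (u s) x, Torus.laplacian (u s) x⟫_ℝ)) * Real.exp (C * K s / (2 * ν ^ 2)) +
        Y s * (Real.exp (C * K s / (2 * ν ^ 2)) * (C * (-(2 * ν * D s)) / (2 * ν ^ 2)))) ?_ ?_
    · intro s hs
      rw [interior_Icc] at hs ⊢
      have hs' : s ∈ S := Ioo_subset_Icc_self hs
      have hmem : S ∈ 𝓝 s := Icc_mem_nhds hs.1 hs.2
      exact ((hGder s hs').hasDerivAt hmem).hasDerivWithinAt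
    · intro s hs
      rw [interior_Icc] at hs
      exact hGder_le s (Ioo_subset_Icc_self hs)
  have haS : a ∈ S := left_mem_Icc.2 hab.le
  have hGta : G t ≤ G a := hGanti haS ht ht.1
  -- unpack
  have heK : ∀ s, 0 < Real.exp (C * K s / (2 * ν ^ 2)) := fun s => Real.exp_pos _
  simp only [hG] at hGta
  have hdiv : Y t ≤ Y a * Real.exp (C * K a / (2 * ν ^ 2)) / Real.exp (C * K t / (2 * ν ^ 2)) := by
    rw [le_div_iff₀ (heK t)]; exact hGta
  calc Torus.gradNormSq (u t) = Y t := rfl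
    _ ≤ Y a * Real.exp (C * K a / (2 * ν ^ 2)) / Real.exp (C * K t / (2 * ν ^ 2)) := hdiv
    _ = Y a * Real.exp (C * (K a - K t) / (2 * ν ^ 2)) := by
        rw [mul_div_assoc, ← Real.exp_sub]
        congr 2
        ring

/-- **Corollary (the usual form).** Under the hypotheses of `gradNormSq_le_mul_exp_of_fracNS`
(`α ≥ 5/4`): `‖∇u(t)‖₂² ≤ ‖∇u(a)‖₂² · exp(C ‖u(a)‖₂² / (2ν²))` on `[a, b]` — a bound by the INITIAL
energy and enstrophy only (the located-gap statement of `estimates.tex` (d): Grönwall-closable for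
`α ≥ 5/4`; Navier–Stokes is `α = 1`). [ours] -/
theorem gradNormSq_le_mul_exp_initial_of_fracNS :
    ∃ C : ℝ, 0 ≤ C ∧ ∀ {α ν a b : ℝ}, 5 / 4 ≤ α → 0 < ν → a < b →
      ∀ {u : ℝ → UnitAddTorus (Fin 3) → EuclideanSpace ℝ (Fin 3)} {p : ℝ → UnitAddTorus (Fin 3) → ℝ},
      Torus.IsFracNSReynoldsOn (Icc a b) α ν u p (fun _ _ _ => 0) →
      ∀ t ∈ Icc a b, Torus.gradNormSq (u t) ≤ Torus.gradNormSq (u a) *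
        Real.exp (C * (∫ x, ‖u a x‖ ^ 2) / (2 * ν ^ 2)) := by
  obtain ⟨C, hC0, hC⟩ := gradNormSq_le_mul_exp_of_fracNS
  refine ⟨C, hC0, ?_⟩
  intro α ν a b hα hν hab u p hsol t ht
  have h1 := hC hα hν hab hsol t ht
  refine h1.trans (mul_le_mul_of_nonneg_left (Real.exp_le_exp.2 ?_) (Torus.gradNormSq_nonneg _))
  have hKt : 0 ≤ ∫ x, ‖u t x‖ ^ 2 := integral_nonneg fun x => sq_nonneg _
  have hν2 : 0 < 2 * ν ^ 2 := by positivity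
  exact div_le_div_of_nonneg_right (by nlinarith) hν2.le

/-- **The row `α = 5/4` (J.-L. Lions' exponent itself).** [ours] -/
theorem gradNormSq_le_mul_exp_initial_of_fracNS_fiveQuarter :
    ∃ C : ℝ, 0 ≤ C ∧ ∀ {ν a b : ℝ}, 0 < ν → a < b →
      ∀ {u : ℝ → UnitAddTorus (Fin 3) → EuclideanSpace ℝ (Fin 3)} {p : ℝ → UnitAddTorus (Fin 3) → ℝ},
      Torus.IsFracNSReynoldsOn (Icc a b) (5 / 4) ν u p (fun _ _ _ => 0) →
      ∀ t ∈ Icc a b, Torus.gradNormSq (u t) ≤ Torus.gradNormSq (u a) *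
        Real.exp (C * (∫ x, ‖u a x‖ ^ 2) / (2 * ν ^ 2)) := by
  obtain ⟨C, hC0, hC⟩ := gradNormSq_le_mul_exp_initial_of_fracNS
  exact ⟨C, hC0, fun hν hab _ _ hsol t ht => hC le_rfl hν hab hsol t ht⟩

end HyperNS

end Summit.NavierStokesRegularity.FunctionalMining

end
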